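import Literature.AlgebraicGeometry.Frobenioids.EquivalenceFrobeniusOfPreSteps
import Literature.AlgebraicGeometry.Frobenioids.EquivalenceFrobeniusDegrees
import HarnessLib

/-!
# Frobenioids I, §3: Theorem 3.4 (iii) from Theorem 3.4 (ii) — Frobenius degrees ((F3)) and the
# preservation list, isotropic type (pre-step preservation as a HYPOTHESIS)

Mochizuki, *The geometry of Frobenioids I: the general theory*, Kyushu J. Math. **62** (2008),
Thm. 3.4 (iii), proof, kurims pp. 64–65: claim (F3) ("if `ζ₁, θ₁ ∈ End(A₁)` are prime-Frobenius
base-identity endomorphisms such that `deg_Fr(ζ₁) < deg_Fr(θ₁)`, then `deg_Fr(ζ₂) < deg_Fr(θ₂)`") and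
"`Ψ` preserves … linear morphisms [by Proposition 1.7, (iii)] … base-isomorphisms …, pull-back morphisms
[cf. Proposition 1.7, (ii)], isometries …, co-angular morphisms …, and LB-invertible morphisms"
[cite: MochizukiFrdI2008, Thm. 3.4 (iii) p.64].

PROOF-ONLY file (seat abc-iut-L1-t11; GAP-LEDGER row G-L1d8-1). As in
`EquivalenceFrobeniusOfPreSteps.lean`: the proofs of seat abc-iut-L1-t13
(`EquivalenceFrobeniusDegrees.lean`, `EquivalenceLinearMorphisms.lean`,
`EquivalenceFrobeniusQuasiIsotropic.lean` §isotropic) re-run with the conclusion of Thm. 3.4 (ii) for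
`Ψ` and `Ψ⁻¹` ("`Ψ`, `Ψ⁻¹` preserve pre-steps", hypotheses `hΨ`, `hΨ'`) in place of "bases of FSM-type".
Standing hypotheses: `C₁`, `C₂` Frobenioids of isotropic type, `Φ₁`, `Φ₂` non-dilating, non-group-like
objects on both sides, `Ψ : C₁ ⥲ C₂`. Results (namespace `FrdI.OfPreSteps`): `isFrobeniusType_map`,
`degFr_map_of_isPrimeFrobenius` (`Ψ^{ℕ≥1} = id`), `degFr_map_of_isotropic` (every Frobenius degree is
preserved), `isLinear_map`, `isBaseIso_map`, `isPullbackMorphism_map`, `isIsometry_map`,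
`isLBInvertible_map`. No statement of the paper is restated or strengthened.
-/

set_option backward.isDefEq.respectTransparency false

namespace Literature.AlgebraicGeometry.Frobenioids

open CategoryTheory Opposite

universe w v v' u u'

namespace FrdI

namespace OfPreSteps

section Two

variable {D₁ : Type u} [Category.{v} D₁] {Φ₁ : D₁ᵒᵖ ⥤ CommMonCat.{w}} {C₁ : Type u'}
  [Category.{v'} C₁] {D₂ : Type u} [Category.{v} D₂] {Φ₂ : D₂ᵒᵖ ⥤ CommMonCat.{w}} {C₂ : Type u'}
  [Category.{v'} C₂] {F₁ : C₁ ⥤ ElemFrobenioid Φ₁} {F₂ : C₂ ⥤ ElemFrobenioid Φ₂}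

/-! ### Frobenius type -/

/-- **Thm. 3.4 (iii): the Frobenius degree of the image of a prime-Frobenius morphism depends only on
its degree** (the assignment `p ↦ p'` of the printed proof, i.e. `Ψ^{ℕ≥1}` on primes).
[cite: MochizukiFrdI2008, Thm. 3.4 (iii) p.64] -/
theorem degFr_map_eq_of_degFr_eq (hF₁ : PreFrobenioid.IsFrobenioid F₁)
    (hF₂ : PreFrobenioid.IsFrobenioid F₂) (hi₁ : ∀ A : C₁, PreFrobenioid.IsIsotropic F₁ A)
    (hi₂ : ∀ A : C₂, PreFrobenioid.IsIsotropic F₂ A) (hnd₂ : IsNonDilatingOn Φ₂) (Ψ : C₁ ≌ C₂)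
    (hΨ : ∀ ⦃A B : C₁⦄ ⦃φ : A ⟶ B⦄, PreFrobenioid.IsPreStep F₁ φ →
      PreFrobenioid.IsPreStep F₂ (Ψ.functor.map φ))
    (hΨ' : ∀ ⦃A B : C₂⦄ ⦃φ : A ⟶ B⦄, PreFrobenioid.IsPreStep F₂ φ →
      PreFrobenioid.IsPreStep F₁ (Ψ.inverse.map φ))
    {N : C₁} (hN : ¬ PreFrobenioid.IsGroupLikeObj F₁ N)
    {A A' B B' : C₁} {f : A ⟶ A'} {g : B ⟶ B'} (hf : PreFrobenioid.IsPrimeFrobenius F₁ f)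
    (hg : PreFrobenioid.IsPrimeFrobenius F₁ g) (hd : PreFrobenioid.degFr F₁ f = PreFrobenioid.degFr F₁ g) :
    PreFrobenioid.degFr F₂ (Ψ.functor.map f) = PreFrobenioid.degFr F₂ (Ψ.functor.map g) := by
  obtain ⟨p', -, hall⟩ := exists_admissible_all hF₁ hF₂ hi₁ hi₂ hnd₂ Ψ hΨ hΨ' hN
    (PreFrobenioid.degFr F₁ f) hf.2
  rw [(hall A f hf.1 rfl).2, (hall B g hg.1 hd.symm).2]

/-- **Thm. 3.4 (iii): `Ψ` preserves morphisms of Frobenius type** (isotropic type, `Φ₂` non-dilating,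
`Ψ`, `Ψ⁻¹` preserving pre-steps, `C₁` with a non-group-like object): composites of prime-Frobenius
morphisms (Prop. 1.10 (v)). [cite: MochizukiFrdI2008, Thm. 3.4 (iii) p.64] -/
theorem isFrobeniusType_map (hF₁ : PreFrobenioid.IsFrobenioid F₁)
    (hF₂ : PreFrobenioid.IsFrobenioid F₂) (hi₁ : ∀ A : C₁, PreFrobenioid.IsIsotropic F₁ A)
    (hi₂ : ∀ A : C₂, PreFrobenioid.IsIsotropic F₂ A) (hnd₂ : IsNonDilatingOn Φ₂) (Ψ : C₁ ≌ C₂)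
    (hΨ : ∀ ⦃A B : C₁⦄ ⦃φ : A ⟶ B⦄, PreFrobenioid.IsPreStep F₁ φ →
      PreFrobenioid.IsPreStep F₂ (Ψ.functor.map φ))
    (hΨ' : ∀ ⦃A B : C₂⦄ ⦃φ : A ⟶ B⦄, PreFrobenioid.IsPreStep F₂ φ →
      PreFrobenioid.IsPreStep F₁ (Ψ.inverse.map φ))
    {N : C₁} (hN : ¬ PreFrobenioid.IsGroupLikeObj F₁ N) :
    ∀ (n : ℕ) {A A' : C₁} {f : A ⟶ A'}, PreFrobenioid.IsFrobeniusType F₁ f →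
      (PreFrobenioid.degFr F₁ f : ℕ) = n → PreFrobenioid.IsFrobeniusType F₂ (Ψ.functor.map f) := by
  intro n
  induction n using Nat.strong_induction_on with
  | _ n ih =>
    intro A A' f hf hn
    by_cases h1 : PreFrobenioid.degFr F₁ f = 1
    · haveI := PreFrobenioid.isIso_of_isFrobeniusType_of_degFr_eq_one hF₁ hf h1
      exact PreFrobenioid.isFrobeniusType_of_isIso F₂ hF₂.isPreFrobenioid _
    · have hn1 : n ≠ 1 := fun h => h1 (PNat.eq (by rw [PNat.one_coe, ← h, hn]))
      have hp : (Nat.minFac n).Prime := Nat.minFac_prime hn1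
      obtain ⟨k, hk⟩ := Nat.minFac_dvd n
      have hnpos : 0 < n := by rw [← hn]; exact PNat.pos _
      have hkpos : 0 < k := Nat.pos_of_ne_zero fun h0 => by
        rw [h0, mul_zero] at hk; exact hnpos.ne' hk
      obtain ⟨X, μ, ν, hμν, hμ, hμd, hν, hνd⟩ := PreFrobenioid.exists_split_of_isFrobeniusType hF₁ hf
        ⟨Nat.minFac n, Nat.minFac_pos n⟩ ⟨k, hkpos⟩ (PNat.eq (by rw [PNat.mul_coe, hn]; exact hk))
      have hμp : PreFrobenioid.IsPrimeFrobenius F₁ μ := ⟨hμ, by rw [hμd]; exact hp⟩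
      have hklt : k < n := by
        rw [hk]
        exact lt_mul_left hkpos hp.one_lt
      rw [← hμν, Functor.map_comp]
      exact PreFrobenioid.IsFrobeniusType.comp F₂ hF₂
        (isPrimeFrobenius_map hF₁ hF₂ hi₁ hi₂ hnd₂ Ψ hΨ hΨ' hN hμp).1
        (ih k hklt hν (by rw [hνd]; rfl))

/-! ### (F3): Frobenius degrees -/

/-- **(F3), monotonicity.** For `Div`-identity prime-Frobenius endomorphisms `ζ`, `θ` of a non-group-like
object with `deg ζ ≤ deg θ`, the images satisfy `deg Ψζ ≤ deg Ψθ` (isotropic type, `Φ₂` non-dilating,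
`Ψ`, `Ψ⁻¹` preserving pre-steps). [cite: MochizukiFrdI2008, Thm. 3.4 (iii) p.65] -/
theorem degFr_map_le (hF₁ : PreFrobenioid.IsFrobenioid F₁) (hF₂ : PreFrobenioid.IsFrobenioid F₂)
    (hi₁ : ∀ A : C₁, PreFrobenioid.IsIsotropic F₁ A) (hi₂ : ∀ A : C₂, PreFrobenioid.IsIsotropic F₂ A)
    (hnd₂ : IsNonDilatingOn Φ₂) (Ψ : C₁ ≌ C₂)
    (hΨ : ∀ ⦃A B : C₁⦄ ⦃φ : A ⟶ B⦄, PreFrobenioid.IsPreStep F₁ φ →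
      PreFrobenioid.IsPreStep F₂ (Ψ.functor.map φ))
    (hΨ' : ∀ ⦃A B : C₂⦄ ⦃φ : A ⟶ B⦄, PreFrobenioid.IsPreStep F₂ φ →
      PreFrobenioid.IsPreStep F₁ (Ψ.inverse.map φ))
    {A : C₁} (hA : ¬ PreFrobenioid.IsGroupLikeObj F₁ A) {ζ θ : A ⟶ A}
    (hζd : PreFrobenioid.IsDivIdentity F₁ ζ) (hζ : PreFrobenioid.IsPrimeFrobenius F₁ ζ)
    (hθd : PreFrobenioid.IsDivIdentity F₁ θ) (hθ : PreFrobenioid.IsPrimeFrobenius F₁ θ)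
    (hle : (PreFrobenioid.degFr F₁ ζ : ℕ) ≤ (PreFrobenioid.degFr F₁ θ : ℕ)) :
    (PreFrobenioid.degFr F₂ (Ψ.functor.map ζ) : ℕ) ≤ (PreFrobenioid.degFr F₂ (Ψ.functor.map θ) : ℕ) := by
  have hP₁ := hF₁.isPreFrobenioid
  have hP₂ := hF₂.isPreFrobenioid
  -- a step `α : A → B`
  obtain ⟨x, hx⟩ : ∃ x : Φ₁.obj (op (PreFrobenioid.baseObj F₁ A)), x ≠ 1 := by
    by_contra h
    push Not at h
    exact hA h
  obtain ⟨B, α, hαc, hαx⟩ := hF₁.iii_d_under_surj A x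
  have hα : PreFrobenioid.IsStep F₁ α := ⟨hαc.2, fun h => hx (by
    rw [← hαx]; haveI := h; exact PreFrobenioid.isIsometry_of_isIso F₁ hP₁ α)⟩
  -- the squares of Prop. 1.14 (v) for `ζ` and `θ`, and the factorisation `βθ = βζ ≫ γ`
  obtain ⟨Bζ, ψζ, βζ, hψζ, hβζ, hsqζ⟩ :=
    PreFrobenioid.exists_square_of_isDivIdentity_isPrimeFrobenius F₁ hF₁ hi₁ hζd hζ α hα
  obtain ⟨Bθ, ψθ, βθ, hψθ, hβθ, hsqθ⟩ :=
    PreFrobenioid.exists_square_of_isDivIdentity_isPrimeFrobenius F₁ hF₁ hi₁ hθd hθ α hα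
  obtain ⟨γ, hγ, hfac⟩ := exists_fac_of_degFr_le hF₁ hi₁ hζd hζ hθd hθ hα hψζ hβζ hsqζ hψθ hβθ hsqθ hle
  -- everything in `C₂`
  obtain ⟨hΨζd, hΨζ⟩ := isDivIdentity_isPrimeFrobenius_map hF₁ hF₂ hi₁ hi₂ hnd₂ Ψ hΨ hΨ' hA hζd hζ
  obtain ⟨hΨθd, hΨθ⟩ := isDivIdentity_isPrimeFrobenius_map hF₁ hF₂ hi₁ hi₂ hnd₂ Ψ hΨ hΨ' hA hθd hθ
  have hΨα := isStep_map Ψ hΨ hα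
  have hns : ∀ {X Y : C₁} {ψ : X ⟶ Y}, IsIrreducibleHom ψ ∧ ¬ PreFrobenioid.IsPreStep F₁ ψ →
      IsIrreducibleHom (Ψ.functor.map ψ) ∧ ¬ PreFrobenioid.IsPreStep F₂ (Ψ.functor.map ψ) :=
    fun h => ⟨h.1.map_equivalence Ψ, fun h' => h.2 (isPreStep_of_map Ψ hΨ' h')⟩
  have hsqζ₂ : Ψ.functor.map α ≫ Ψ.functor.map ψζ =
      Ψ.functor.map ζ ≫ Ψ.functor.map α ≫ Ψ.functor.map βζ := by
    rw [← Functor.map_comp, hsqζ, Functor.map_comp, Functor.map_comp]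
  have hsqθ₂ : Ψ.functor.map α ≫ Ψ.functor.map ψθ =
      Ψ.functor.map θ ≫ Ψ.functor.map α ≫ Ψ.functor.map βθ := by
    rw [← Functor.map_comp, hsqθ, Functor.map_comp, Functor.map_comp]
  have h1 := pull_div_mul_of_square hF₂ hi₂ hΨζd hΨζ hΨα (hns hψζ) (isStep_map Ψ hΨ hβζ) hsqζ₂
  have h2 := pull_div_mul_of_square hF₂ hi₂ hΨθd hΨθ hΨα (hns hψθ) (isStep_map Ψ hΨ hβθ) hsqθ₂
  -- `Div Ψβθ = (transported Div Ψγ) * Div Ψβζ`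
  have hγ₂ : PreFrobenioid.IsPreStep F₂ (Ψ.functor.map γ) := hΨ hγ
  have h3 : PreFrobenioid.Div F₂ (Ψ.functor.map βθ) =
      pull Φ₂ (PreFrobenioid.Base F₂ (Ψ.functor.map βζ)) (PreFrobenioid.Div F₂ (Ψ.functor.map γ)) *
        PreFrobenioid.Div F₂ (Ψ.functor.map βζ) := by
    rw [← hfac, Functor.map_comp, PreFrobenioid.div_comp,
      show PreFrobenioid.degFr F₂ (Ψ.functor.map γ) = 1 from hγ₂.1, PNat.one_coe, pow_one]
  haveI : IsCancelMul (Φ₂.obj (op (PreFrobenioid.baseObj F₂ (Ψ.functor.obj A)))) :=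
    isIntegral_iff_isCancelMul.1 (hP₂.isDivisorial _).isPreDivisorial.isIntegral
  refine le_of_pow_eq_pow_mul (hP₂.isDivisorial _).isSharp
    (PreFrobenioid.div_ne_one_of_isStep hi₂ hΨα)
    (c := pull Φ₂ (PreFrobenioid.Base F₂ (Ψ.functor.map α))
      (pull Φ₂ (PreFrobenioid.Base F₂ (Ψ.functor.map βζ)) (PreFrobenioid.Div F₂ (Ψ.functor.map γ)))) ?_
  rw [← h2, ← h1, h3, map_mul]
  simp only [mul_assoc, mul_comm]

/-- **Thm. 3.4 (iii), (F3): `Ψ` preserves the Frobenius degrees of prime-Frobenius morphisms**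
(`Ψ^{ℕ≥1} = id`) — Frobenioids of isotropic type, `Φ₁`, `Φ₂` non-dilating, non-group-like objects on
both sides, `Ψ`, `Ψ⁻¹` preserving pre-steps. Induction on the degree: consistency of `p ↦ p'` for `Ψ`
and `Ψ⁻¹`, and monotonicity. [cite: MochizukiFrdI2008, Thm. 3.4 (iii) p.65] -/
theorem degFr_map_of_isPrimeFrobenius (hF₁ : PreFrobenioid.IsFrobenioid F₁)
    (hF₂ : PreFrobenioid.IsFrobenioid F₂) (hi₁ : ∀ A : C₁, PreFrobenioid.IsIsotropic F₁ A)
    (hi₂ : ∀ A : C₂, PreFrobenioid.IsIsotropic F₂ A) (hnd₁ : IsNonDilatingOn Φ₁)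
    (hnd₂ : IsNonDilatingOn Φ₂) (Ψ : C₁ ≌ C₂)
    (hΨ : ∀ ⦃A B : C₁⦄ ⦃φ : A ⟶ B⦄, PreFrobenioid.IsPreStep F₁ φ →
      PreFrobenioid.IsPreStep F₂ (Ψ.functor.map φ))
    (hΨ' : ∀ ⦃A B : C₂⦄ ⦃φ : A ⟶ B⦄, PreFrobenioid.IsPreStep F₂ φ →
      PreFrobenioid.IsPreStep F₁ (Ψ.inverse.map φ))
    {N₁ : C₁} (hN₁ : ¬ PreFrobenioid.IsGroupLikeObj F₁ N₁) {N₂ : C₂}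
    (hN₂ : ¬ PreFrobenioid.IsGroupLikeObj F₂ N₂) :
    ∀ (n : ℕ) {A A' : C₁} {f : A ⟶ A'}, PreFrobenioid.IsPrimeFrobenius F₁ f →
      (PreFrobenioid.degFr F₁ f : ℕ) = n → (PreFrobenioid.degFr F₂ (Ψ.functor.map f) : ℕ) = n := by
  obtain ⟨T, ⟨z, hz⟩, hT⟩ := exists_frobeniusTrivial_not_isGroupLikeObj hF₁ hN₁
  obtain ⟨T₂, ⟨z₂, hz₂⟩, hT₂⟩ := exists_frobeniusTrivial_not_isGroupLikeObj hF₂ hN₂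
  -- the base-identity `r`-Frobenius endomorphisms of `T`, `T₂`
  have hzp : ∀ r : ℕ+, (r : ℕ).Prime → PreFrobenioid.IsDivIdentity F₁ (z r) ∧
      PreFrobenioid.IsPrimeFrobenius F₁ (z r) ∧ PreFrobenioid.degFr F₁ (z r) = r := fun r hr =>
    ⟨isDivIdentity_of_isBaseIdentity (hz r).2.1, ⟨(hz r).2.2, by rw [(hz r).1]; exact hr⟩, (hz r).1⟩
  have hz₂p : ∀ r : ℕ+, (r : ℕ).Prime →
      PreFrobenioid.IsPrimeFrobenius F₂ (z₂ r) ∧ PreFrobenioid.degFr F₂ (z₂ r) = r := fun r hr =>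
    ⟨⟨(hz₂ r).2.2, by rw [(hz₂ r).1]; exact hr⟩, (hz₂ r).1⟩
  intro n
  induction n using Nat.strong_induction_on with
  | _ n ih =>
    intro A A' f hf hn
    have hΨf := isPrimeFrobenius_map hF₁ hF₂ hi₁ hi₂ hnd₂ Ψ hΨ hΨ' hN₁ hf
    set p' : ℕ := (PreFrobenioid.degFr F₂ (Ψ.functor.map f) : ℕ) with hp'def
    have hp' : p'.Prime := hΨf.2
    have hp : n.Prime := by rw [← hn]; exact hf.2
    rcases lt_trichotomy p' n with hlt | heq | hgt
    · -- (a) `p' < n`: the `p'`-Frobenius endomorphism of `T` also maps to degree `p'`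
      exfalso
      obtain ⟨-, hgp, hgd⟩ := hzp ⟨p', hp'.pos⟩ hp'
      have hΨg : (PreFrobenioid.degFr F₂ (Ψ.functor.map (z ⟨p', hp'.pos⟩)) : ℕ) = p' :=
        ih p' hlt hgp (by rw [hgd]; rfl)
      -- consistency for `Ψ⁻¹` on the prime-Frobenius morphisms `Ψ f`, `Ψ g` of equal degree
      have hΨgp := isPrimeFrobenius_map hF₁ hF₂ hi₁ hi₂ hnd₂ Ψ hΨ hΨ' hN₁ hgp
      have hdeg : PreFrobenioid.degFr F₂ (Ψ.functor.map f) =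
          PreFrobenioid.degFr F₂ (Ψ.functor.map (z ⟨p', hp'.pos⟩)) := PNat.eq (by rw [hΨg])
      have hc := degFr_map_eq_of_degFr_eq hF₂ hF₁ hi₂ hi₁ hnd₁ Ψ.symm hΨ' hΨ hN₂ hΨf hΨgp hdeg
      change PreFrobenioid.degFr F₁ (Ψ.inverse.map (Ψ.functor.map f)) =
        PreFrobenioid.degFr F₁ (Ψ.inverse.map (Ψ.functor.map _)) at hc
      rw [degFr_inv_map_map, degFr_inv_map_map, hgd] at hc
      have : n = p' := by rw [← hn, hc]; rfl
      exact hlt.ne this.symm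
    · exact heq
    · -- (c) `p' > n`: look at the `n`-Frobenius endomorphism `h` of `T₂` and `ρ := Ψ⁻¹ h`
      exfalso
      obtain ⟨hhp, hhd⟩ := hz₂p ⟨n, hp.pos⟩ hp
      have hρ := isPrimeFrobenius_map hF₂ hF₁ hi₂ hi₁ hnd₁ Ψ.symm hΨ' hΨ hN₂ hhp
      change PreFrobenioid.IsPrimeFrobenius F₁ (Ψ.inverse.map (z₂ ⟨n, hp.pos⟩)) at hρ
      set r : ℕ := (PreFrobenioid.degFr F₁ (Ψ.inverse.map (z₂ ⟨n, hp.pos⟩)) : ℕ) with hrdef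
      have hr : r.Prime := hρ.2
      -- `deg Ψ ρ = n`
      have hΨρ : (PreFrobenioid.degFr F₂ (Ψ.functor.map (Ψ.inverse.map (z₂ ⟨n, hp.pos⟩))) : ℕ) = n := by
        rw [Ψ.fun_inv_map, PreFrobenioid.degFr_comp, PreFrobenioid.degFr_comp,
          show PreFrobenioid.degFr F₂ (Ψ.counit.app _) = 1 from PreFrobenioid.isLinear_of_isIso F₂ _,
          show PreFrobenioid.degFr F₂ (Ψ.counitInv.app _) = 1 from PreFrobenioid.isLinear_of_isIso F₂ _,
          one_mul, mul_one, hhd]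
        rfl
      rcases lt_trichotomy r n with hrl | hre | hrg
      · -- `r < n`: induction hypothesis
        have := ih r hrl hρ rfl
        rw [hΨρ] at this
        exact hrl.ne this.symm
      · -- `r = n`: consistency for `Ψ`
        have hdeg : PreFrobenioid.degFr F₁ f = PreFrobenioid.degFr F₁ (Ψ.inverse.map (z₂ ⟨n, hp.pos⟩)) :=
          PNat.eq (hn.trans hre.symm)
        have hc := degFr_map_eq_of_degFr_eq hF₁ hF₂ hi₁ hi₂ hnd₂ Ψ hΨ hΨ' hN₁ hf hρ hdeg
        have : p' = n := by rw [hp'def, hc, hΨρ]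
        exact hgt.ne this.symm
      · -- `r > n`: monotonicity at `T` between the `n`- and `r`-Frobenius endomorphisms
        obtain ⟨hnd', hnp, hndeg⟩ := hzp ⟨n, hp.pos⟩ hp
        obtain ⟨hrd', hrp, hrdeg⟩ := hzp ⟨r, hr.pos⟩ hr
        have hmono := degFr_map_le hF₁ hF₂ hi₁ hi₂ hnd₂ Ψ hΨ hΨ' hT hnd' hnp hrd' hrp
          (by rw [hndeg, hrdeg]; exact hrg.le)
        -- `deg Ψ(z n) = p'` and `deg Ψ(z r) = n` by consistency
        have hc1 := degFr_map_eq_of_degFr_eq hF₁ hF₂ hi₁ hi₂ hnd₂ Ψ hΨ hΨ' hN₁ hf hnp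
          (PNat.eq (by rw [hn, hndeg]; rfl))
        have hc2 := degFr_map_eq_of_degFr_eq hF₁ hF₂ hi₁ hi₂ hnd₂ Ψ hΨ hΨ' hN₁ hρ hrp
          (PNat.eq (by rw [hrdeg]; rfl))
        rw [← hc1, ← hc2] at hmono
        have : p' ≤ n := by rw [hp'def, ← hΨρ]; exact hmono
        exact absurd hgt (not_lt.2 this)

/-- Isotropic type: `Ψ` preserves the Frobenius degree of morphisms of Frobenius type ((F3) on the
prime-Frobenius factors, Prop. 1.10 (v)). [cite: MochizukiFrdI2008, Thm. 3.4 (iii) p.64] -/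
theorem degFr_map_of_isFrobeniusType (hF₁ : PreFrobenioid.IsFrobenioid F₁)
    (hF₂ : PreFrobenioid.IsFrobenioid F₂) (hi₁ : ∀ A : C₁, PreFrobenioid.IsIsotropic F₁ A)
    (hi₂ : ∀ A : C₂, PreFrobenioid.IsIsotropic F₂ A) (hnd₁ : IsNonDilatingOn Φ₁)
    (hnd₂ : IsNonDilatingOn Φ₂) (Ψ : C₁ ≌ C₂)
    (hΨ : ∀ ⦃A B : C₁⦄ ⦃φ : A ⟶ B⦄, PreFrobenioid.IsPreStep F₁ φ →
      PreFrobenioid.IsPreStep F₂ (Ψ.functor.map φ))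
    (hΨ' : ∀ ⦃A B : C₂⦄ ⦃φ : A ⟶ B⦄, PreFrobenioid.IsPreStep F₂ φ →
      PreFrobenioid.IsPreStep F₁ (Ψ.inverse.map φ))
    {N₁ : C₁} (hN₁ : ¬ PreFrobenioid.IsGroupLikeObj F₁ N₁) {N₂ : C₂}
    (hN₂ : ¬ PreFrobenioid.IsGroupLikeObj F₂ N₂) :
    ∀ (n : ℕ) {A A' : C₁} {f : A ⟶ A'}, PreFrobenioid.IsFrobeniusType F₁ f →
      (PreFrobenioid.degFr F₁ f : ℕ) = n → (PreFrobenioid.degFr F₂ (Ψ.functor.map f) : ℕ) = n := by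
  intro n
  induction n using Nat.strong_induction_on with
  | _ n ih =>
    intro A A' f hf hn
    by_cases h1 : PreFrobenioid.degFr F₁ f = 1
    · haveI := PreFrobenioid.isIso_of_isFrobeniusType_of_degFr_eq_one hF₁ hf h1
      rw [← hn, h1, show PreFrobenioid.degFr F₂ (Ψ.functor.map f) = 1 from
        PreFrobenioid.isLinear_of_isIso F₂ _]
    · have hn1 : n ≠ 1 := fun h => h1 (PNat.eq (by rw [PNat.one_coe, ← h, hn]))
      have hp : (Nat.minFac n).Prime := Nat.minFac_prime hn1
      obtain ⟨k, hk⟩ := Nat.minFac_dvd n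
      have hnpos : 0 < n := by rw [← hn]; exact PNat.pos _
      have hkpos : 0 < k := Nat.pos_of_ne_zero fun h0 => by
        rw [h0, mul_zero] at hk; exact hnpos.ne' hk
      obtain ⟨X, μ, ν, hμν, hμ, hμd, hν, hνd⟩ := PreFrobenioid.exists_split_of_isFrobeniusType hF₁ hf
        ⟨Nat.minFac n, Nat.minFac_pos n⟩ ⟨k, hkpos⟩ (PNat.eq (by rw [PNat.mul_coe, hn]; exact hk))
      have hμp : PreFrobenioid.IsPrimeFrobenius F₁ μ := ⟨hμ, by rw [hμd]; exact hp⟩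
      have hklt : k < n := by
        rw [hk]
        exact lt_mul_left hkpos hp.one_lt
      rw [← hμν, Functor.map_comp, PreFrobenioid.degFr_comp, PNat.mul_coe,
        degFr_map_of_isPrimeFrobenius hF₁ hF₂ hi₁ hi₂ hnd₁ hnd₂ Ψ hΨ hΨ' hN₁ hN₂ (Nat.minFac n) hμp
          (by rw [hμd]; rfl), ih k hklt hν (by rw [hνd]; rfl)]
      exact hk.symm

end Two

end OfPreSteps

end FrdI

end Literature.AlgebraicGeometry.Frobenioids
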